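import Mathlib.Data.Nat.Factorization.Induction
import Summits.KontsevichZagierPeriods.KontsevichZagierPeriods.Theorems.HurwitzMicroSectorsNormalFormPrincipleDlogMoves
import Summits.KontsevichZagierPeriods.KontsevichZagierPeriods.Theorems.HurwitzMicroSectorsNormalFormPrincipleSplitMoves

/-!
# `NormalFormPrinciple` (stmt-KontsevichZagierPeriods-3869), registered sub-goal
# `box_split_mem_relations` — part A: prime carriers in `FormalRep ⧸ relations`

Siege file (Mathlib-API variation) towards the registered sub-goal `box_split_mem_relations` of
the crux `NormalFormPrinciple` (BoxVanishing in dimension one for `ℚ`-split denominators).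
Everything is phrased in the quotient group `FormalRep ⧸ KZ.relations` (Mathlib `QuotientAddGroup`),
where the moves become equations and bookkeeping is `abel` / `Finset.sum`. Contents:

* bridge lemmas between `KZ.relations` and `QuotientAddGroup.mk' relations`;
* the **prime carriers** `Λ(n, c) = [(1,n), c/y]` (`n : ℕ`, `c : ℚ`): additivity in `c`,
  multiplicativity in `n` (`carrier_mul`, one split + one dilation), and the decomposition of
  `Λ(n, c)` into prime carriers (`carrier_primes`, Mathlib's `induction_on_primes`);
* every dlog representation `[(a,b), c/y]` with rational `0 < a`, `b` is a `ℚ`-combination of prime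
  carriers modulo relations (`dlog_eq_sum_carriers`);
* a simple rational pole `[(0,1), c/(x − ρ)]`, `ρ ∉ [0,1]`, is one affine move away from a dlog
  representation, hence also such a combination (`pole_one_eq_sum_carriers`).

No definitions are introduced: the carrier family is a hypothesis `hΛ` on a function
`Λ : ℕ → ℚ → IntegralRep 1` (dischargeable by `Dlog.exists_dlog`).
Sources: M. Kontsevich, D. Zagier, *Periods* (2001), §1.1 (`log 2 = ∫₁² dx/x`), §1.2 rules (1), (2).
-/

noncomputable section

open MeasureTheory Set
open scoped Polynomial
open Literature.NumberTheory.Transcendental Literature.NumberTheory.Transcendental.KZ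

namespace Summit.KontsevichZagierPeriods.HurwitzMicroSectors.NormalFormPrinciple.PiBox

namespace BoxSplit

open Dlog

open QuotientAddGroup (mk')

/-! ## Bridge: relations versus the quotient -/

/-- `a − b ∈ relations` gives equal classes. [cite: KontsevichZagier2001, §1.2] -/
theorem mk_eq_mk_of_sub_mem {a b : FormalRep} (h : a - b ∈ relations) :
    mk' relations a = mk' relations b := by
  rw [QuotientAddGroup.mk'_apply, QuotientAddGroup.mk'_apply, QuotientAddGroup.eq_iff_sub_mem]
  exact h

/-- Equal classes give `a − b ∈ relations`. [cite: KontsevichZagier2001, §1.2] -/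
theorem sub_mem_of_mk_eq_mk {a b : FormalRep} (h : mk' relations a = mk' relations b) :
    a - b ∈ relations := by
  rwa [QuotientAddGroup.mk'_apply, QuotientAddGroup.mk'_apply, QuotientAddGroup.eq_iff_sub_mem] at h

/-- A three-term relation `a − b − c ∈ relations` read in the quotient.
[cite: KontsevichZagier2001, §1.2] -/
theorem mk_eq_add_of_sub_sub_mem {a b c : FormalRep} (h : a - b - c ∈ relations) :
    mk' relations a = mk' relations b + mk' relations c := by
  rw [← map_add]
  exact mk_eq_mk_of_sub_mem (by rwa [← sub_sub])

/-- A relation has class `0`. [cite: KontsevichZagier2001, §1.2] -/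
theorem mk_eq_zero_of_mem {a : FormalRep} (h : a ∈ relations) : mk' relations a = 0 := by
  rwa [QuotientAddGroup.mk'_apply, QuotientAddGroup.eq_zero_iff]

/-- Class `0` means relation. [cite: KontsevichZagier2001, §1.2] -/
theorem mem_of_mk_eq_zero {a : FormalRep} (h : mk' relations a = 0) : a ∈ relations := by
  rwa [QuotientAddGroup.mk'_apply, QuotientAddGroup.eq_zero_iff] at h

/-! ## The prime carriers `Λ(n, c) = [(1,n), c/y]` -/

section Carriers

variable {Λ : ℕ → ℚ → IntegralRep 1}
  (hΛ : ∀ (n : ℕ) (c : ℚ), (Λ n c).domain = {x | x 0 ∈ Set.Ioo ((1:ℚ):ℝ) ((n:ℚ):ℝ)} ∧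
    (Λ n c).integrand = fun x => (c:ℝ) / x 0)
include hΛ

/-- `Λ(n, 0) ≡ 0` (zero integrand). [cite: KontsevichZagier2001, §1.2 rule (1)] -/
theorem carrier_zero (n : ℕ) : mk' relations (of (Λ n 0)) = 0 :=
  mk_eq_zero_of_mem (dlog_zero_mem_relations _ (by rw [(hΛ n 0).2]; exact fun _ _ => rfl))

/-- `Λ(n, c) ≡ 0` for `n ≤ 1` (empty slab). [cite: KontsevichZagier2001, §1.2 rule (1)] -/
theorem carrier_of_le_one {n : ℕ} (hn : n ≤ 1) (c : ℚ) : mk' relations (of (Λ n c)) = 0 :=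
  mk_eq_zero_of_mem (slab_empty_mem_relations _ (hΛ n c).1 (by exact_mod_cast hn))

/-- **Additivity of carriers in the coefficient** (rule 1b): `Λ(n, c + c') ≡ Λ(n, c) + Λ(n, c')`.
[cite: KontsevichZagier2001, §1.2 rule (1)] -/
theorem carrier_add (n : ℕ) (c c' : ℚ) :
    mk' relations (of (Λ n (c + c'))) = mk' relations (of (Λ n c)) + mk' relations (of (Λ n c')) :=
  mk_eq_add_of_sub_sub_mem (dlog_merge_mem_relations _ _ _ (hΛ n _).1 (hΛ n c).1 (hΛ n c').1
    (by rw [(hΛ n _).2]; exact fun _ _ => rfl) (by rw [(hΛ n c).2]; exact fun _ _ => rfl)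
    (by rw [(hΛ n c').2]; exact fun _ _ => rfl))

/-- `Λ(n, −c) ≡ −Λ(n, c)`. [cite: KontsevichZagier2001, §1.2 rule (1)] -/
theorem carrier_neg (n : ℕ) (c : ℚ) :
    mk' relations (of (Λ n (-c))) = -mk' relations (of (Λ n c)) := by
  have h := carrier_add hΛ n c (-c)
  rw [add_neg_cancel, carrier_zero hΛ] at h
  exact (neg_eq_of_add_eq_zero_right h.symm).symm

/-- **Multiplicativity of carriers** `Λ(m n, c) ≡ Λ(m, c) + Λ(n, c)` (`1 ≤ m, n`): split `(1, m n)`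
at `m` (rule 1a) and identify `[(m, m n), c/y]` with `[(1, n), c/y]` by the dilation `y ↦ m y`
(rule 2). [cite: KontsevichZagier2001, §1.1 and §1.2 rules (1), (2)] -/
theorem carrier_mul {m n : ℕ} (hm : 1 ≤ m) (hn : 1 ≤ n) (c : ℚ) :
    mk' relations (of (Λ (m * n) c)) =
      mk' relations (of (Λ m c)) + mk' relations (of (Λ n c)) := by
  obtain ⟨M, hMd, hMi⟩ := exists_dlog ((m:ℚ) * 1) ((m:ℚ) * n) c (by positivity)
  have hscale : mk' relations (of (Λ n c)) = mk' relations (of M) :=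
    mk_eq_mk_of_sub_mem (dlog_scale_mem_relations (Λ n c) M (hΛ n c).1 hMd
      (by rw [(hΛ n c).2]; exact fun _ _ => rfl) (by rw [hMi]; exact fun _ _ => rfl) one_pos
      (by exact_mod_cast hm))
  have hsplit : mk' relations (of (Λ (m * n) c)) =
      mk' relations (of (Λ m c)) + mk' relations (of M) := by
    refine mk_eq_add_of_sub_sub_mem (split_mem_relations (Λ (m * n) c) (Λ m c) M (hΛ _ c).1
      (hΛ m c).1 ?_ (by exact_mod_cast hm) ?_
      (by rw [(hΛ m c).2, (hΛ _ c).2]; exact fun _ _ => rfl)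
      (by rw [hMi, (hΛ _ c).2]; exact fun _ _ => rfl))
    · rw [hMd, mul_one, ← Nat.cast_mul]
    · exact_mod_cast Nat.le_mul_of_pos_right m hn
  rw [hsplit, hscale]

/-- Sums of carriers over a larger index set with vanishing extra coefficients.
[cite: KontsevichZagier2001, §1.2] -/
theorem sum_carrier_subset {S T : Finset ℕ} (hST : S ⊆ T) {C : ℕ → ℚ}
    (hC : ∀ p, p ∉ S → C p = 0) :
    ∑ p ∈ T, mk' relations (of (Λ p (C p))) = ∑ p ∈ S, mk' relations (of (Λ p (C p))) := by
  refine (Finset.sum_subset hST fun p _ hpS => ?_).symm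
  rw [hC p hpS, carrier_zero hΛ]

/-- **Sum of two carrier expansions** is the carrier expansion with added coefficients.
[cite: KontsevichZagier2001, §1.2] -/
theorem sum_carrier_add (S S' : Finset ℕ) (C C' : ℕ → ℚ) (hC : ∀ p, p ∉ S → C p = 0)
    (hC' : ∀ p, p ∉ S' → C' p = 0) :
    ∑ p ∈ S, mk' relations (of (Λ p (C p))) + ∑ p ∈ S', mk' relations (of (Λ p (C' p))) =
      ∑ p ∈ S ∪ S', mk' relations (of (Λ p (C p + C' p))) := by
  rw [← sum_carrier_subset hΛ Finset.subset_union_left hC,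
    ← sum_carrier_subset hΛ (Finset.subset_union_right (s₁ := S)) hC', ← Finset.sum_add_distrib]
  exact Finset.sum_congr rfl fun p _ => (carrier_add hΛ p _ _).symm

/-- **Prime decomposition of carriers**: for `n ≠ 0`, `Λ(n, c) ≡ Σ_{p | n} v_p(n) Λ(p, c)`, stated
as the existence of a prime-supported coefficient vector (Mathlib `induction_on_primes` and
`carrier_mul`; `Λ(1, c) ≡ 0`). [cite: KontsevichZagier2001, §1.1] -/
theorem carrier_primes : ∀ n : ℕ, n ≠ 0 → ∀ c : ℚ, ∃ (S : Finset ℕ) (C : ℕ → ℚ),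
    (∀ p ∈ S, p.Prime) ∧ (∀ p, p ∉ S → C p = 0) ∧
      mk' relations (of (Λ n c)) = ∑ p ∈ S, mk' relations (of (Λ p (C p))) := by
  refine induction_on_primes (fun h => absurd rfl h)
    (fun _ c => ⟨∅, fun _ => 0, by simp, by simp, ?_⟩) fun p a hp ih hpa c => ?_
  · rw [Finset.sum_empty]
    exact carrier_of_le_one hΛ le_rfl c
  · have ha : a ≠ 0 := fun h => hpa (by rw [h, mul_zero])
    obtain ⟨S, C, hS, hC, hsum⟩ := ih ha c
    refine ⟨{p} ∪ S, fun q => (if q = p then c else 0) + C q, fun q hq => ?_, fun q hq => ?_, ?_⟩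
    · rcases Finset.mem_union.mp hq with hq | hq
      · rw [Finset.mem_singleton.mp hq]; exact hp
      · exact hS q hq
    · rw [Finset.mem_union, not_or, Finset.mem_singleton] at hq
      beta_reduce
      rw [if_neg hq.1, hC q hq.2, add_zero]
    · rw [carrier_mul hΛ hp.one_lt.le (Nat.one_le_iff_ne_zero.mpr ha), hsum,
        ← sum_carrier_add hΛ {p} S _ C (fun q hq => if_neg (by simpa using hq)) hC,
        Finset.sum_singleton, if_pos rfl]

/-! ## Dlog representations are combinations of prime carriers -/

omit hΛ in
/-- Two positive rationals have a common positive rational multiplier making both positive integers.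
[folklore] -/
theorem exists_nat_scaling {a b : ℚ} (ha : 0 < a) (hb : 0 < b) :
    ∃ (s : ℚ) (A B : ℕ), 0 < s ∧ 1 ≤ A ∧ s * a = A ∧ s * b = B := by
  have hna : (a.num.toNat : ℤ) = a.num := Int.toNat_of_nonneg (Rat.num_nonneg.mpr ha.le)
  have hnb : (b.num.toNat : ℤ) = b.num := Int.toNat_of_nonneg (Rat.num_nonneg.mpr hb.le)
  have hna' : ((a.num.toNat : ℕ) : ℚ) = (a.num : ℚ) := by rw [← Int.cast_natCast, hna]
  have hnb' : ((b.num.toNat : ℕ) : ℚ) = (b.num : ℚ) := by rw [← Int.cast_natCast, hnb]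
  refine ⟨(a.den : ℚ) * b.den, a.num.toNat * b.den, b.num.toNat * a.den, by positivity, ?_, ?_, ?_⟩
  · have h1 : 0 < a.num.toNat := by
      have := Rat.num_pos.mpr ha
      omega
    exact Nat.one_le_iff_ne_zero.mpr (Nat.mul_ne_zero h1.ne' b.den_nz)
  · push_cast
    rw [hna', ← Rat.mul_den_eq_num a]
    ring
  · push_cast
    rw [hnb', ← Rat.mul_den_eq_num b]
    ring

omit hΛ in
/-- Helper: membership of the closed unit interval from its failure pattern. [folklore] -/
theorem lt_or_lt_of_not_mem_Icc {ρ : ℚ} (hρ : (ρ:ℝ) ∉ Set.Icc (0:ℝ) 1) : ρ < 0 ∨ 1 < ρ := by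
  rcases lt_or_ge ρ 0 with h | h
  · exact Or.inl h
  · exact Or.inr (lt_of_not_ge fun h' => hρ ⟨by exact_mod_cast h, by exact_mod_cast h'⟩)

/-- **A dlog representation is a `ℚ`-combination of prime carriers modulo relations**:
`[(a,b), c/y] ≡ Σ_p C_p Λ(p)` — scale to integer ends `(A, B)` (rule 2), write
`[(A,B)] ≡ Λ(B) − Λ(A)` (split of `(1,B)` at `A`), and decompose both carriers into primes.
[cite: KontsevichZagier2001, §1.1 and §1.2 rules (1), (2)] -/
theorem dlog_eq_sum_carriers {a b c : ℚ} (ha : 0 < a) (L : IntegralRep 1)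
    (hd : L.domain = {x | x 0 ∈ Set.Ioo (a:ℝ) b})
    (hi : EqOn L.integrand (fun x => (c:ℝ) / x 0) L.domain) :
    ∃ (S : Finset ℕ) (C : ℕ → ℚ), (∀ p ∈ S, p.Prime) ∧ (∀ p, p ∉ S → C p = 0) ∧
      mk' relations (of L) = ∑ p ∈ S, mk' relations (of (Λ p (C p))) := by
  rcases le_or_gt b a with hba | hab
  · refine ⟨∅, fun _ => 0, by simp, by simp, ?_⟩
    rw [Finset.sum_empty]
    exact mk_eq_zero_of_mem (slab_empty_mem_relations L hd (by exact_mod_cast hba))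
  obtain ⟨s, A, B, hs, hA, hsa, hsb⟩ := exists_nat_scaling ha (ha.trans hab)
  obtain ⟨L', hd', hi'⟩ := exists_dlog (s * a) (s * b) c (by positivity)
  have h1 : mk' relations (of L) = mk' relations (of L') := mk_eq_mk_of_sub_mem
    (dlog_scale_mem_relations L L' hd hd' hi (by rw [hi']; exact fun _ _ => rfl) ha hs)
  have hAB : (A:ℚ) ≤ B := by
    rw [← hsa, ← hsb]
    exact mul_le_mul_of_nonneg_left hab.le hs.le
  have hd'' : L'.domain = {x | x 0 ∈ Set.Ioo (((A:ℕ):ℚ):ℝ) (((B:ℕ):ℚ):ℝ)} := by rw [hd', hsa, hsb]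
  have h2 : mk' relations (of (Λ B c)) = mk' relations (of (Λ A c)) + mk' relations (of L') :=
    mk_eq_add_of_sub_sub_mem (split_mem_relations (Λ B c) (Λ A c) L' (hΛ B c).1 (hΛ A c).1 hd''
      (by exact_mod_cast hA) (by exact_mod_cast hAB)
      (by rw [(hΛ A c).2, (hΛ B c).2]; exact fun _ _ => rfl)
      (by rw [hi', (hΛ B c).2]; exact fun _ _ => rfl))
  have hB : 1 ≤ B := by exact_mod_cast (show (1:ℚ) ≤ B from (Nat.one_le_cast.mpr hA).trans hAB)
  obtain ⟨S₁, C₁, hS₁, hC₁, e₁⟩ := carrier_primes hΛ B (by omega) c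
  obtain ⟨S₂, C₂, hS₂, hC₂, e₂⟩ := carrier_primes hΛ A (by omega) (-c)
  refine ⟨S₁ ∪ S₂, fun p => C₁ p + C₂ p, fun p hp => ?_, fun p hp => ?_, ?_⟩
  · rcases Finset.mem_union.mp hp with hp | hp
    · exact hS₁ p hp
    · exact hS₂ p hp
  · rw [Finset.mem_union, not_or] at hp
    beta_reduce
    rw [hC₁ p hp.1, hC₂ p hp.2, add_zero]
  · rw [h1, ← sum_carrier_add hΛ S₁ S₂ C₁ C₂ hC₁ hC₂, ← e₁, ← e₂, carrier_neg hΛ, h2]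
    abel

end Carriers

/-- **A simple rational pole off `[0,1]` is a `ℚ`-combination of prime carriers** (registered
sub-goal `pole_one_eq_sum_carriers` of stmt-KontsevichZagierPeriods-3869, helper layer of the siege on
`box_split_mem_relations`): `[(0,1), c/(x − ρ)]` is carried onto the dlog representation
`[(−ρ, 1−ρ), c/y]` by `y = x − ρ` (`ρ < 0`) or onto `[(ρ−1, ρ), −c/y]` by `y = ρ − x` (`ρ > 1`), one
affine move (rule 2) each, and dlog representations are combinations of prime carriers
(`dlog_eq_sum_carriers`). [cite: KontsevichZagier2001, §1.2 rule (2)] -/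
theorem pole_one_eq_sum_carriers {Λ : ℕ → ℚ → IntegralRep 1}
    (hΛ : ∀ (n : ℕ) (c : ℚ), (Λ n c).domain = {x | x 0 ∈ Set.Ioo ((1:ℚ):ℝ) ((n:ℚ):ℝ)} ∧
      (Λ n c).integrand = fun x => (c:ℝ) / x 0)
    {c ρ : ℚ} (hρ : (ρ:ℝ) ∉ Set.Icc (0:ℝ) 1) (T : IntegralRep 1)
    (hTd : T.domain = {x | x 0 ∈ Set.Ioo (0:ℝ) 1})
    (hTi : EqOn T.integrand (fun x => (c:ℝ) / (x 0 - ρ)) T.domain) :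
    ∃ (S : Finset ℕ) (C : ℕ → ℚ), (∀ p ∈ S, p.Prime) ∧ (∀ p, p ∉ S → C p = 0) ∧
      QuotientAddGroup.mk' relations (of T) =
        ∑ p ∈ S, QuotientAddGroup.mk' relations (of (Λ p (C p))) := by
  rcases lt_or_lt_of_not_mem_Icc hρ with hneg | hbig
  · -- shift `y = x − ρ`
    obtain ⟨L, hLd, hLi⟩ := exists_dlog (-ρ) (1 - ρ) c (neg_pos.mpr hneg)
    have hTL : mk' relations (of T) = mk' relations (of L) := by
      have hs : (0:ℝ) < ((1:ℚ):ℝ) := by norm_num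
      have eA : ((1:ℚ):ℝ) * 0 + ((-ρ:ℚ):ℝ) = ((-ρ:ℚ):ℝ) := by ring
      have eB : ((1:ℚ):ℝ) * 1 + ((-ρ:ℚ):ℝ) = ((1 - ρ:ℚ):ℝ) := by push_cast; ring
      refine mk_eq_mk_of_sub_mem (affine_sub_mem_relations (s := 1) (t := -ρ) one_ne_zero T L
        (fun y => (c:ℝ) / y) ?_ (by rw [hLi]; exact fun _ _ => rfl) fun x hx => ?_)
      · rw [hTd, image_affine_slab_of_pos hs (((-ρ:ℚ)):ℝ) 0 1, eA, eB, hLd]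
      · rw [hTi hx]
        push_cast
        rw [abs_one, one_mul, mul_one, sub_eq_add_neg]
    obtain ⟨S, C, hS, hC, e⟩ :=
      dlog_eq_sum_carriers hΛ (neg_pos.mpr hneg) L hLd (by rw [hLi]; exact fun _ _ => rfl)
    exact ⟨S, C, hS, hC, hTL.trans e⟩
  · -- flip `y = ρ − x`
    obtain ⟨L, hLd, hLi⟩ := exists_dlog (ρ - 1) ρ (-c) (by linarith)
    have hTL : mk' relations (of T) = mk' relations (of L) := by
      have hs : (((-1:ℚ)):ℝ) < 0 := by norm_num
      have eA : ((-1:ℚ):ℝ) * 1 + ((ρ:ℚ):ℝ) = ((ρ - 1:ℚ):ℝ) := by push_cast; ring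
      have eB : ((-1:ℚ):ℝ) * 0 + ((ρ:ℚ):ℝ) = ((ρ:ℚ):ℝ) := by ring
      refine mk_eq_mk_of_sub_mem (affine_sub_mem_relations (s := -1) (t := ρ) (by norm_num) T L
        (fun y => ((-c:ℚ):ℝ) / y) ?_ (by rw [hLi]; exact fun _ _ => rfl) fun x hx => ?_)
      · rw [hTd, image_affine_slab_of_neg hs ((ρ:ℚ):ℝ) 0 1, eA, eB, hLd]
      · rw [hTi hx]
        show (c:ℝ) / (x 0 - ρ) = ((-c:ℚ):ℝ) / (((-1:ℚ):ℝ) * x 0 + ρ) * |((-1:ℚ):ℝ)|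
        simp only [Rat.cast_neg, Rat.cast_one, abs_neg, abs_one, mul_one, neg_mul, one_mul]
        rw [show -x 0 + (ρ:ℝ) = -(x 0 - ρ) by ring, div_neg, neg_div, neg_neg]
    obtain ⟨S, C, hS, hC, e⟩ :=
      dlog_eq_sum_carriers hΛ (by linarith) L hLd (by rw [hLi]; exact fun _ _ => rfl)
    exact ⟨S, C, hS, hC, hTL.trans e⟩

end BoxSplit

end Summit.KontsevichZagierPeriods.HurwitzMicroSectors.NormalFormPrinciple.PiBox
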